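import Summits.ValiantsHypothesis.ValiantsHypothesis.Theorems.DefinabilityGapSlideSupport
import HarnessLib

/-!
# Definability gap — THREE GRAPHICAL GATES SURVIVE EVERY `hB`-LEVEL (Theorem A of O-L5-LEVEL)

Helper-lane file F-N₂b of OFFER O-L5-LEVEL «VERTEX-SUPPORT COUNT» (decomp-val-lens-5 g40; RULING + CALL GO
decomp-val-crit-1 g11) on the `KIPlantedHittingRO` helper lane (`stmt-ValiantsHypothesis-23704`). Notation as in
`DefinabilityGapSlideSupport`: block labels `B = Fin 3 → Fin (qOf m)`, GATES `eprod E = Π_{(u,v) ∈ E} (z_u − z_v)`,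
the collapse `ρ_e = rename (repL [e])` (`z_v ↦ z_u`, `e = (u, v)`), and the patched substitution
`φ_L = bind₁ (fun c => wordPoly m (wordL m L c))` for a patch list `L` whose merged-away labels `p.2` are pairwise
distinct (`hB`). DEF-FREE: one theorem.

THEOREM A `wordL_threeGates_eqCard` (Mason-free, primality-free, LEVEL-STABLE). Let `L` be an `hB`-patch list with
`2·3^(|L|+2) < m²` and `E₁ E₂ E₃` edge multisets of one size `n` whose edges are ORIENTED (`toLex e.1 < toLex e.2`)
and LIVE at level `L` (no endpoint is a merged-away label). Then for all coefficients
`f := α₁·eprod E₁ + α₂·eprod E₂ + α₃·eprod E₃ ≠ 0 ⟹ φ_L f ≠ 0`.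

PROOF (the ENGINE; induction on `n`; every tool BY NAME from `DefinabilityGapSlideSupport` / `…SlideCount` /
`…EdgeGates` / `…ForestSums`, nothing re-derived). (E0) a zero coefficient: TWO GATES UNDER PATCHES
`bind₁_wordL_twoGates_ne_zero` (`2·3^(|L|+1) < m²`); `n = 0`: `f` is a nonzero constant. (E1) an edge `e` common
to the three gates: `f = (z_{e.1} − z_{e.2})·f'`, the factor SURVIVES (`wordPoly_wordL_ne'`, `2·3^|L| < m²`) and
`f'` falls under the induction hypothesis. Suppose now `φ_L f = 0`. (E2′) an edge in exactly two gates is excluded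
by MERGE KILLS TWO `bind₁_wordL_ne_zero_of_mem_mem` (three rotations), so the gates are pairwise edge-disjoint,
hence pairwise disjoint as unordered pairs (`sym2_ne_of_toLex_lt`). (E3a) a FREE collapse (`ρ_e f ≠ 0` for some
edge `e`) is excluded by `bind₁_wordL_ne_zero_of_free` (three rotations). (E3b) STUCK (every `ρ_e` kills `f`):
by `slide_of_rename_threeGates_eq_zero` in five directions the loopless, nonempty, pairwise disjoint edge SETS
`S_i := E_i.toFinset` satisfy the slide hypotheses of the VERTEX-SUPPORT COUNT `card_labels_le_four`, so all
endpoints lie in a set `T` of at most FOUR labels; the live labels of `T` carry `vars f`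
(`vars_C_mul_eprod_subset`), and the PATCHED SUPPORT RUNG `bind₁_wordL_ne_zero'` with
`2·3^|L|·(4 − 1) = 2·3^(|L|+1) < m²` gives `φ_L f ≠ 0` — contradiction. WHY LEVEL-STABLE: every step keeps the
hypothesis shape (`hB`-list, live oriented edges) and descends at most two levels (`E2′` / `E3a` pass to `e :: L`,
where TWO GATES UNDER PATCHES descends once more), whence the budget `2·3^(|L|+2) < m²`.

HONEST BOUNDARY (O-L5-LEVEL): proved here are (A) level-stable survival of THREE equal-size graphical gates on
oriented live edges under every patch list L whose merged labels are pairwise distinct, with 2·3^(|L|+2) < m², and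
(B) hitting by G_m of every nonzero sum of FOUR pairwise edge-disjoint graphical gates on oriented edges for m ≥ 8,
on every union support; NOT claimed: four gates with an edge shared by exactly two of them (this needs a
classification of slide-equivalent gate pairs, not done), five or more gates (the free recursion leaves the pairwise
edge-disjoint class), the k-set analogue of the four-label count, affine non-graphical forms, the leaf regime;
nothing here is S-currency, no item closes, stmt-23704 and VP ≠ VNP are untouched.

USE: F-N₃ `DefinabilityGapGraphicalFour` runs Theorem A at level `L = [e]` under a free collapse of a fan-in-4
circuit (`m ≥ 8`: `2·3³ = 54 < 64 ≤ m²`). UNDECIDED · IDEA-NEEDED (fan-in 4 with a doubly-shared edge, fan-in ≥ 5,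
the k-set analogue of the count, (β) affine non-graphical, (γ) leaf regime) · 0 S-currency · closes NO item ·
stmt-23704 TEXT / K1 / VP ≠ VNP untouched.
-/

open MvPolynomial
open Literature.Computability.AlgebraicComplexity Literature.Computability.MetaComplexity
open Summit.ValiantsHypothesis.ValiantsHypothesis.Theorems.DefinabilityGapAffineRung
open Summit.ValiantsHypothesis.ValiantsHypothesis.Theorems.DefinabilityGapBlockMerging
open Summit.ValiantsHypothesis.ValiantsHypothesis.Theorems.DefinabilityGapClusterMerging
open Summit.ValiantsHypothesis.ValiantsHypothesis.Theorems.DefinabilityGapForestSums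
open Summit.ValiantsHypothesis.ValiantsHypothesis.Theorems.DefinabilityGapSupportRung
open Summit.ValiantsHypothesis.ValiantsHypothesis.Theorems.DefinabilityGapEdgeGates
open Summit.ValiantsHypothesis.ValiantsHypothesis.Theorems.DefinabilityGapSlideCount
open Summit.ValiantsHypothesis.ValiantsHypothesis.Theorems.DefinabilityGapSlideSupport

set_option linter.dupNamespace false

namespace Summit.ValiantsHypothesis.ValiantsHypothesis.Theorems.DefinabilityGapThreeGatesPatched

variable {m : ℕ}

/-- ★ THEOREM A (ENGINE, level `L`, equal sizes `n`): three graphical gates on oriented live edges survive `φ_L`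
for every `hB`-patch list with `2·3^(|L|+2) < m²`. (E0) two gates / a constant; (E1) peel a common edge, the factor
SURVIVES; then suppose `φ_L f = 0`: (E2′) MERGE KILLS TWO; (E3a) FREE collapse; (E3b) STUCK: five slides →
`card_labels_le_four` → the PATCHED SUPPORT RUNG on at most four live labels. [this file] -/
theorem wordL_threeGates_eqCard {L : List ((Fin 3 → Fin (qOf m)) × (Fin 3 → Fin (qOf m)))}
    (hB : L.Pairwise fun p p' => p.2 ≠ p'.2) (hmL : 2 * 3 ^ (L.length + 2) < m * m) (n : ℕ) :
    ∀ (E₁ E₂ E₃ : Multiset ((Fin 3 → Fin (qOf m)) × (Fin 3 → Fin (qOf m)))) (α₁ α₂ α₃ : ℂ),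
      Multiset.card E₁ = n → Multiset.card E₂ = n → Multiset.card E₃ = n →
      (∀ e ∈ E₁ + E₂ + E₃, toLex e.1 < toLex e.2 ∧ (∀ p ∈ L, e.1 ≠ p.2) ∧ ∀ p ∈ L, e.2 ≠ p.2) →
      C α₁ * eprod E₁ + C α₂ * eprod E₂ + C α₃ * eprod E₃ ≠ 0 →
      bind₁ (fun c => wordPoly m (wordL m L c)) (C α₁ * eprod E₁ + C α₂ * eprod E₂ + C α₃ * eprod E₃) ≠ 0 := by
  have hmL1 : 2 * 3 ^ (L.length + 1) < m * m :=
    lt_of_le_of_lt (Nat.mul_le_mul_left 2 (Nat.pow_le_pow_right (by norm_num) (Nat.le_succ _))) hmL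
  have hmL0 : 2 * 3 ^ L.length < m * m :=
    lt_of_le_of_lt (Nat.mul_le_mul_left 2 (Nat.pow_le_pow_right (by norm_num) (Nat.le_succ _))) hmL1
  -- membership bookkeeping for the three rotations of `E₁ + E₂ + E₃`
  have rot : ∀ (E₁ E₂ E₃ : Multiset ((Fin 3 → Fin (qOf m)) × (Fin 3 → Fin (qOf m)))),
      ∀ e ∈ E₂ + E₃ + E₁, e ∈ E₁ + E₂ + E₃ := by
    intro E₁ E₂ E₃ e he
    rcases Multiset.mem_add.1 he with he | he
    · rcases Multiset.mem_add.1 he with he | he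
      · exact Multiset.mem_add.2 (Or.inl (Multiset.mem_add.2 (Or.inr he)))
      · exact Multiset.mem_add.2 (Or.inr he)
    · exact Multiset.mem_add.2 (Or.inl (Multiset.mem_add.2 (Or.inl he)))
  have m₁ : ∀ (E₁ E₂ E₃ : Multiset ((Fin 3 → Fin (qOf m)) × (Fin 3 → Fin (qOf m)))),
      ∀ e ∈ E₁, e ∈ E₁ + E₂ + E₃ := fun E₁ E₂ E₃ e he =>
    Multiset.mem_add.2 (Or.inl (Multiset.mem_add.2 (Or.inl he)))
  have m₂ : ∀ (E₁ E₂ E₃ : Multiset ((Fin 3 → Fin (qOf m)) × (Fin 3 → Fin (qOf m)))),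
      ∀ e ∈ E₂, e ∈ E₁ + E₂ + E₃ := fun E₁ E₂ E₃ e he =>
    Multiset.mem_add.2 (Or.inl (Multiset.mem_add.2 (Or.inr he)))
  have m₃ : ∀ (E₁ E₂ E₃ : Multiset ((Fin 3 → Fin (qOf m)) × (Fin 3 → Fin (qOf m)))),
      ∀ e ∈ E₃, e ∈ E₁ + E₂ + E₃ := fun E₁ E₂ E₃ e he => Multiset.mem_add.2 (Or.inr he)
  induction n with
  | zero =>
    intro E₁ E₂ E₃ α₁ α₂ α₃ c₁ c₂ c₃ _ hf
    rw [Multiset.card_eq_zero] at c₁ c₂ c₃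
    rw [c₁, c₂, c₃, eprod_zero, mul_one, mul_one, mul_one, ← C_add, ← C_add] at hf ⊢
    rw [bind₁_C_right]
    exact MvPolynomial.C_ne_zero.2 (MvPolynomial.C_ne_zero.1 hf)
  | succ n ih =>
    intro E₁ E₂ E₃ α₁ α₂ α₃ c₁ c₂ c₃ ho hf
    have hl : ∀ e ∈ E₁ + E₂ + E₃, e.1 ≠ e.2 ∧ (∀ p ∈ L, e.1 ≠ p.2) ∧ ∀ p ∈ L, e.2 ≠ p.2 :=
      fun e he => ⟨fun h => (ho e he).1.ne (congrArg toLex h), (ho e he).2.1, (ho e he).2.2⟩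
    -- (E0) a zero coefficient: TWO GATES UNDER PATCHES
    by_cases hα₁ : α₁ = 0
    · rw [hα₁, C_0, zero_mul, zero_add] at hf ⊢
      exact bind₁_wordL_twoGates_ne_zero hB hmL1 E₂ E₃ α₂ α₃ (fun e he => hl e (by
        rcases Multiset.mem_add.1 he with he | he
        · exact m₂ E₁ E₂ E₃ e he
        · exact m₃ E₁ E₂ E₃ e he)) hf
    by_cases hα₂ : α₂ = 0
    · rw [hα₂, C_0, zero_mul, add_zero] at hf ⊢
      exact bind₁_wordL_twoGates_ne_zero hB hmL1 E₁ E₃ α₁ α₃ (fun e he => hl e (by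
        rcases Multiset.mem_add.1 he with he | he
        · exact m₁ E₁ E₂ E₃ e he
        · exact m₃ E₁ E₂ E₃ e he)) hf
    by_cases hα₃ : α₃ = 0
    · rw [hα₃, C_0, zero_mul, add_zero] at hf ⊢
      exact bind₁_wordL_twoGates_ne_zero hB hmL1 E₁ E₂ α₁ α₂ (fun e he => hl e (by
        rcases Multiset.mem_add.1 he with he | he
        · exact m₁ E₁ E₂ E₃ e he
        · exact m₂ E₁ E₂ E₃ e he)) hf
    -- (E1) an edge common to the three gates is peeled off (its image SURVIVES)
    by_cases hcom : ∃ e ∈ E₁, e ∈ E₂ ∧ e ∈ E₃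
    · obtain ⟨e, he₁, he₂, he₃⟩ := hcom
      obtain ⟨hne, he₁', he₂'⟩ := hl e (m₁ E₁ E₂ E₃ e he₁)
      obtain ⟨E₁', rfl⟩ := Multiset.exists_cons_of_mem he₁
      obtain ⟨E₂', rfl⟩ := Multiset.exists_cons_of_mem he₂
      obtain ⟨E₃', rfl⟩ := Multiset.exists_cons_of_mem he₃
      have hfac : C α₁ * eprod (e ::ₘ E₁') + C α₂ * eprod (e ::ₘ E₂') + C α₃ * eprod (e ::ₘ E₃') =
          (X e.1 - X e.2) * (C α₁ * eprod E₁' + C α₂ * eprod E₂' + C α₃ * eprod E₃') := by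
        rw [eprod_cons, eprod_cons, eprod_cons]; ring
      rw [hfac] at hf ⊢
      rw [map_mul, map_sub, bind₁_X_right, bind₁_X_right]
      rw [Multiset.card_cons] at c₁ c₂ c₃
      refine mul_ne_zero (sub_ne_zero.2 (wordPoly_wordL_ne' hB hmL0 hne he₁' he₂')) ?_
      refine ih E₁' E₂' E₃' α₁ α₂ α₃ (by omega) (by omega) (by omega) (fun d hd => ho d ?_)
        (right_ne_zero_of_mul hf)
      rcases Multiset.mem_add.1 hd with hd | hd
      · rcases Multiset.mem_add.1 hd with hd | hd
        · exact m₁ _ _ _ d (Multiset.mem_cons_of_mem hd)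
        · exact m₂ _ _ _ d (Multiset.mem_cons_of_mem hd)
      · exact m₃ _ _ _ d (Multiset.mem_cons_of_mem hd)
    -- no common edge; suppose `φ_L f = 0`
    intro h0
    have ho₂ : ∀ e ∈ E₂ + E₃ + E₁, toLex e.1 < toLex e.2 ∧ (∀ p ∈ L, e.1 ≠ p.2) ∧ ∀ p ∈ L, e.2 ≠ p.2 :=
      fun e he => ho e (rot E₁ E₂ E₃ e he)
    have ho₃ : ∀ e ∈ E₃ + E₁ + E₂, toLex e.1 < toLex e.2 ∧ (∀ p ∈ L, e.1 ≠ p.2) ∧ ∀ p ∈ L, e.2 ≠ p.2 :=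
      fun e he => ho e (rot E₁ E₂ E₃ e (rot E₂ E₃ E₁ e he))
    have hl₂ : ∀ e ∈ E₂ + E₃ + E₁, e.1 ≠ e.2 ∧ (∀ p ∈ L, e.1 ≠ p.2) ∧ ∀ p ∈ L, e.2 ≠ p.2 :=
      fun e he => hl e (rot E₁ E₂ E₃ e he)
    have hl₃ : ∀ e ∈ E₃ + E₁ + E₂, e.1 ≠ e.2 ∧ (∀ p ∈ L, e.1 ≠ p.2) ∧ ∀ p ∈ L, e.2 ≠ p.2 :=
      fun e he => hl e (rot E₁ E₂ E₃ e (rot E₂ E₃ E₁ e he))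
    have h0₂ : bind₁ (fun c => wordPoly m (wordL m L c)) (C α₂ * eprod E₂ + C α₃ * eprod E₃ + C α₁ * eprod E₁)
        = 0 := by
      rw [← add_rotate]; exact h0
    have h0₃ : bind₁ (fun c => wordPoly m (wordL m L c)) (C α₃ * eprod E₃ + C α₁ * eprod E₁ + C α₂ * eprod E₂)
        = 0 := by
      rw [add_rotate]; exact h0
    -- oriented edges of different gates that are different are different as unordered pairs
    have hav : ∀ (F G : Multiset ((Fin 3 → Fin (qOf m)) × (Fin 3 → Fin (qOf m)))),
        (∀ e ∈ F, e ∈ E₁ + E₂ + E₃) → (∀ e ∈ G, e ∈ E₁ + E₂ + E₃) → (∀ e ∈ F, e ∉ G) →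
        ∀ e ∈ F, ∀ d ∈ G, d.1 ≠ d.2 ∧ s(d.1, d.2) ≠ s(e.1, e.2) := by
      intro F G hF hG hFG e he d hd
      exact ⟨(hl d (hG d hd)).1, sym2_ne_of_toLex_lt (ho d (hG d hd)).1 (ho e (hF e he)).1
        fun h => hFG e he (by rw [← h]; exact hd)⟩
    -- (E2′) an edge in exactly two gates: MERGE KILLS TWO
    have h₁₂ : ∀ e ∈ E₁, e ∉ E₂ := fun e he₁ he₂ =>
      bind₁_wordL_ne_zero_of_mem_mem hB hmL1 hα₃ he₁ he₂ hl
        (fun g hg => (hav {e} E₃ (fun d hd => by rw [Multiset.mem_singleton.1 hd]; exact m₁ _ _ _ e he₁)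
          (m₃ E₁ E₂ E₃) (fun d hd hd₃ => hcom ⟨e, he₁, he₂, by rw [Multiset.mem_singleton.1 hd] at hd₃; exact hd₃⟩)
          e (Multiset.mem_singleton_self e) g hg).2) h0
    have h₂₃ : ∀ e ∈ E₂, e ∉ E₃ := fun e he₂ he₃ =>
      bind₁_wordL_ne_zero_of_mem_mem hB hmL1 hα₁ he₂ he₃ hl₂
        (fun g hg => (hav {e} E₁ (fun d hd => by rw [Multiset.mem_singleton.1 hd]; exact m₂ _ _ _ e he₂)
          (m₁ E₁ E₂ E₃) (fun d hd hd₁ => hcom ⟨e, by rw [Multiset.mem_singleton.1 hd] at hd₁; exact hd₁, he₂, he₃⟩)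
          e (Multiset.mem_singleton_self e) g hg).2) h0₂
    have h₃₁ : ∀ e ∈ E₃, e ∉ E₁ := fun e he₃ he₁ =>
      bind₁_wordL_ne_zero_of_mem_mem hB hmL1 hα₂ he₃ he₁ hl₃
        (fun g hg => (hav {e} E₂ (fun d hd => by rw [Multiset.mem_singleton.1 hd]; exact m₃ _ _ _ e he₃)
          (m₂ E₁ E₂ E₃) (fun d hd hd₂ => hcom ⟨e, he₁, by rw [Multiset.mem_singleton.1 hd] at hd₂; exact hd₂, he₃⟩)
          e (Multiset.mem_singleton_self e) g hg).2) h0₃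
    have h₂₁ : ∀ e ∈ E₂, e ∉ E₁ := fun e he₂ he₁ => h₁₂ e he₁ he₂
    have h₃₂ : ∀ e ∈ E₃, e ∉ E₂ := fun e he₃ he₂ => h₂₃ e he₂ he₃
    have h₁₃ : ∀ e ∈ E₁, e ∉ E₃ := fun e he₁ he₃ => h₃₁ e he₃ he₁
    -- (E3a) a FREE collapse
    by_cases hfree : ∃ e ∈ E₁ + E₂ + E₃,
        rename (repL [e]) (C α₁ * eprod E₁ + C α₂ * eprod E₂ + C α₃ * eprod E₃) ≠ 0
    · obtain ⟨e, he, hρ⟩ := hfree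
      rcases Multiset.mem_add.1 he with he | he₃
      · rcases Multiset.mem_add.1 he with he₁ | he₂
        · exact bind₁_wordL_ne_zero_of_free hB hmL he₁ hl
            (fun d hd => (hav E₁ E₂ (m₁ E₁ E₂ E₃) (m₂ E₁ E₂ E₃) h₁₂ e he₁ d hd).2)
            (fun d hd => (hav E₁ E₃ (m₁ E₁ E₂ E₃) (m₃ E₁ E₂ E₃) h₁₃ e he₁ d hd).2) hρ h0
        · refine bind₁_wordL_ne_zero_of_free hB hmL he₂ hl₂
            (fun d hd => (hav E₂ E₃ (m₂ E₁ E₂ E₃) (m₃ E₁ E₂ E₃) h₂₃ e he₂ d hd).2)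
            (fun d hd => (hav E₂ E₁ (m₂ E₁ E₂ E₃) (m₁ E₁ E₂ E₃) h₂₁ e he₂ d hd).2) ?_ h0₂
          rw [← add_rotate]; exact hρ
      · refine bind₁_wordL_ne_zero_of_free hB hmL he₃ hl₃
          (fun d hd => (hav E₃ E₁ (m₃ E₁ E₂ E₃) (m₁ E₁ E₂ E₃) h₃₁ e he₃ d hd).2)
          (fun d hd => (hav E₃ E₂ (m₃ E₁ E₂ E₃) (m₂ E₁ E₂ E₃) h₃₂ e he₃ d hd).2) ?_ h0₃
        rw [add_rotate]; exact hρ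
    -- (E3b) STUCK: every collapse kills `f`; the slides force at most four labels
    have hall : ∀ e ∈ E₁ + E₂ + E₃,
        rename (repL [e]) (C α₁ * eprod E₁ + C α₂ * eprod E₂ + C α₃ * eprod E₃) = 0 := by
      intro e he
      by_contra h
      exact hfree ⟨e, he, h⟩
    have hne₁ : E₁.toFinset.Nonempty := by
      obtain ⟨e, he⟩ := Multiset.card_pos_iff_exists_mem.1 (by omega : 0 < Multiset.card E₁)
      exact ⟨e, Multiset.mem_toFinset.2 he⟩
    have hne₂ : E₂.toFinset.Nonempty := by
      obtain ⟨e, he⟩ := Multiset.card_pos_iff_exists_mem.1 (by omega : 0 < Multiset.card E₂)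
      exact ⟨e, Multiset.mem_toFinset.2 he⟩
    obtain ⟨T, hTcard, hT⟩ := card_labels_le_four E₁.toFinset E₂.toFinset E₃.toFinset
      (fun g hg => by
        rcases Finset.mem_union.1 hg with hg | hg
        · rcases Finset.mem_union.1 hg with hg | hg
          · exact (hl g (m₁ _ _ _ g (Multiset.mem_toFinset.1 hg))).1
          · exact (hl g (m₂ _ _ _ g (Multiset.mem_toFinset.1 hg))).1
        · exact (hl g (m₃ _ _ _ g (Multiset.mem_toFinset.1 hg))).1)
      (fun g hg g' hg' h => (hav E₁ E₂ (m₁ E₁ E₂ E₃) (m₂ E₁ E₂ E₃) h₁₂ g (Multiset.mem_toFinset.1 hg) g'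
        (Multiset.mem_toFinset.1 hg')).2 h.symm)
      (fun g hg g' hg' h => (hav E₁ E₃ (m₁ E₁ E₂ E₃) (m₃ E₁ E₂ E₃) h₁₃ g (Multiset.mem_toFinset.1 hg) g'
        (Multiset.mem_toFinset.1 hg')).2 h.symm)
      (fun g hg g' hg' h => (hav E₂ E₃ (m₂ E₁ E₂ E₃) (m₃ E₁ E₂ E₃) h₂₃ g (Multiset.mem_toFinset.1 hg) g'
        (Multiset.mem_toFinset.1 hg')).2 h.symm)
      hne₁ hne₂
      (fun e he g hg => by
        obtain ⟨g', hg', h⟩ := slide_of_rename_threeGates_eq_zero hα₃ (Multiset.mem_toFinset.1 he)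
          (hav E₁ E₃ (m₁ E₁ E₂ E₃) (m₃ E₁ E₂ E₃) h₁₃ e (Multiset.mem_toFinset.1 he))
          (hall e (m₁ _ _ _ e (Multiset.mem_toFinset.1 he))) g (Multiset.mem_toFinset.1 hg)
        exact ⟨g', Multiset.mem_toFinset.2 hg', h⟩)
      (fun e he g hg => by
        obtain ⟨g', hg', h⟩ := slide_of_rename_threeGates_eq_zero hα₂ (Multiset.mem_toFinset.1 he)
          (hav E₁ E₂ (m₁ E₁ E₂ E₃) (m₂ E₁ E₂ E₃) h₁₂ e (Multiset.mem_toFinset.1 he))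
          (by rw [add_right_comm]; exact hall e (m₁ _ _ _ e (Multiset.mem_toFinset.1 he)))
          g (Multiset.mem_toFinset.1 hg)
        exact ⟨g', Multiset.mem_toFinset.2 hg', h⟩)
      (fun e he g hg => by
        obtain ⟨g', hg', h⟩ := slide_of_rename_threeGates_eq_zero hα₃ (Multiset.mem_toFinset.1 he)
          (hav E₂ E₃ (m₂ E₁ E₂ E₃) (m₃ E₁ E₂ E₃) h₂₃ e (Multiset.mem_toFinset.1 he))
          (by rw [add_comm (C α₂ * eprod E₂) (C α₁ * eprod E₁)]
              exact hall e (m₂ _ _ _ e (Multiset.mem_toFinset.1 he)))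
          g (Multiset.mem_toFinset.1 hg)
        exact ⟨g', Multiset.mem_toFinset.2 hg', h⟩)
      (fun e he g hg => by
        obtain ⟨g', hg', h⟩ := slide_of_rename_threeGates_eq_zero hα₁ (Multiset.mem_toFinset.1 he)
          (hav E₂ E₁ (m₂ E₁ E₂ E₃) (m₁ E₁ E₂ E₃) h₂₁ e (Multiset.mem_toFinset.1 he))
          (by rw [← add_rotate]; exact hall e (m₂ _ _ _ e (Multiset.mem_toFinset.1 he)))
          g (Multiset.mem_toFinset.1 hg)
        exact ⟨g', Multiset.mem_toFinset.2 hg', h⟩)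
      (fun e he g hg => by
        obtain ⟨g', hg', h⟩ := slide_of_rename_threeGates_eq_zero hα₂ (Multiset.mem_toFinset.1 he)
          (hav E₃ E₂ (m₃ E₁ E₂ E₃) (m₂ E₁ E₂ E₃) h₃₂ e (Multiset.mem_toFinset.1 he))
          (by rw [add_rotate]; exact hall e (m₃ _ _ _ e (Multiset.mem_toFinset.1 he)))
          g (Multiset.mem_toFinset.1 hg)
        exact ⟨g', Multiset.mem_toFinset.2 hg', h⟩)
    -- the live labels among `T` carry all variables of `f`: PATCHED SUPPORT RUNG
    have hTE : ∀ e ∈ E₁ + E₂ + E₃,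
        e.1 ∈ T.filter (fun c => ∀ p ∈ L, c ≠ p.2) ∧ e.2 ∈ T.filter (fun c => ∀ p ∈ L, c ≠ p.2) := by
      intro e he
      have heT : e.1 ∈ T ∧ e.2 ∈ T := hT e (by
        rcases Multiset.mem_add.1 he with he | he
        · rcases Multiset.mem_add.1 he with he | he
          · exact Finset.mem_union_left _ (Finset.mem_union_left _ (Multiset.mem_toFinset.2 he))
          · exact Finset.mem_union_left _ (Finset.mem_union_right _ (Multiset.mem_toFinset.2 he))
        · exact Finset.mem_union_right _ (Multiset.mem_toFinset.2 he))
      exact ⟨Finset.mem_filter.2 ⟨heT.1, (hl e he).2.1⟩, Finset.mem_filter.2 ⟨heT.2, (hl e he).2.2⟩⟩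
    have hvars : (C α₁ * eprod E₁ + C α₂ * eprod E₂ + C α₃ * eprod E₃).vars ⊆
        T.filter (fun c => ∀ p ∈ L, c ≠ p.2) :=
      (vars_add_subset _ _).trans (Finset.union_subset ((vars_add_subset _ _).trans (Finset.union_subset
        (vars_C_mul_eprod_subset (fun e he => hTE e (m₁ _ _ _ e he)) α₁)
        (vars_C_mul_eprod_subset (fun e he => hTE e (m₂ _ _ _ e he)) α₂)))
        (vars_C_mul_eprod_subset (fun e he => hTE e (m₃ _ _ _ e he)) α₃))
    have hcard : (T.filter (fun c => ∀ p ∈ L, c ≠ p.2)).card ≤ 4 := (Finset.card_filter_le _ _).trans hTcard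
    have hmT : 2 * 3 ^ L.length * ((T.filter (fun c => ∀ p ∈ L, c ≠ p.2)).card - 1) < m * m :=
      lt_of_le_of_lt (Nat.mul_le_mul_left _ (show _ ≤ 3 by omega))
        (lt_of_le_of_lt (by rw [pow_succ, mul_assoc]) hmL1)
    exact bind₁_wordL_ne_zero' hB _ (fun c hc => (Finset.mem_filter.1 hc).2) hmT hf hvars h0

end Summit.ValiantsHypothesis.ValiantsHypothesis.Theorems.DefinabilityGapThreeGatesPatched
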